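import Summits.CriticalPhenomena.PercolationContinuityZ3.Theorems.PercNearOneGluingNoHeavyLowerTailForestRayleighRelabelClass
import HarnessLib

/-!
# Weighted forest negative correlation — pulling the Rayleigh property back along an embedding

`rayleigh_of_embedding`: if `ψ : V → U` is injective and the image system `T.image (Sym2.map ψ)` has
the Rayleigh property (over `U`), then `T` has it (over `V`). (Converse direction to
`rayleigh_of_image`; together: the Rayleigh property is invariant under relabelling and only depends
on the edge system up to isomorphism.) Used to transfer the five-vertex theorems (`…KFive`) to any
vertex type. Theorems only; no definitions, no `sorry`.
-/

open Finset SimpleGraph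
open scoped Classical

namespace Summit.CriticalPhenomena.PercolationContinuityZ3.Theorems.ForestRayleigh

variable {U V : Type*} [Fintype U] [DecidableEq U] [Fintype V] [DecidableEq V]

/-- **Pull-back of the Rayleigh property along an injective relabelling** `ψ : V → U`:
`(R)` for every instance inside `T.image (Sym2.map ψ)` (over `U`, all activities) gives `(R)` for
every instance inside `T` (over `V`). The activities are pushed forward (`w' (ψz) = w z`, `0` off the
image) and the four partition functions agree by `forestsW_image`. [elementary] -/
theorem rayleigh_of_embedding (ψ : V → U) (hψ : Function.Injective ψ) (T : Finset (Sym2 V))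
    (hT : ∀ z ∈ T, ¬z.IsDiag)
    (hR : ∀ (w : Sym2 U → ℝ), (∀ x, 0 ≤ w x) → ∀ (D K : Finset (Sym2 U)) (e f : Sym2 U),
      D ∪ insert e (insert f K) ⊆ (T.image (Sym2.map ψ)) → Disjoint D K → e ∉ D → e ∉ K → f ∉ D →
      f ∉ K → e ≠ f →
      (∑ G ∈ D.powerset.filter (fun G =>
        (fromEdgeSet ((G ∪ (insert e (insert f (K))) : Finset (Sym2 U)) : Set (Sym2 U))).IsAcyclic), ∏ x ∈ G, w x) *
        (∑ G ∈ D.powerset.filter (fun G =>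
        (fromEdgeSet ((G ∪ (K) : Finset (Sym2 U)) : Set (Sym2 U))).IsAcyclic), ∏ x ∈ G, w x) ≤
      (∑ G ∈ D.powerset.filter (fun G =>
        (fromEdgeSet ((G ∪ (insert e (K)) : Finset (Sym2 U)) : Set (Sym2 U))).IsAcyclic), ∏ x ∈ G, w x) *
        (∑ G ∈ D.powerset.filter (fun G =>
        (fromEdgeSet ((G ∪ (insert f (K)) : Finset (Sym2 U)) : Set (Sym2 U))).IsAcyclic), ∏ x ∈ G, w x))
    :
    ∀ (w : Sym2 V → ℝ), (∀ x, 0 ≤ w x) → ∀ (D K : Finset (Sym2 V)) (e f : Sym2 V),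
      D ∪ insert e (insert f K) ⊆ T → Disjoint D K → e ∉ D → e ∉ K → f ∉ D →
      f ∉ K → e ≠ f →
      (∑ G ∈ D.powerset.filter (fun G =>
        (fromEdgeSet ((G ∪ (insert e (insert f (K))) : Finset (Sym2 V)) : Set (Sym2 V))).IsAcyclic), ∏ x ∈ G, w x) *
        (∑ G ∈ D.powerset.filter (fun G =>
        (fromEdgeSet ((G ∪ (K) : Finset (Sym2 V)) : Set (Sym2 V))).IsAcyclic), ∏ x ∈ G, w x) ≤
      (∑ G ∈ D.powerset.filter (fun G =>
        (fromEdgeSet ((G ∪ (insert e (K)) : Finset (Sym2 V)) : Set (Sym2 V))).IsAcyclic), ∏ x ∈ G, w x) *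
        (∑ G ∈ D.powerset.filter (fun G =>
        (fromEdgeSet ((G ∪ (insert f (K)) : Finset (Sym2 V)) : Set (Sym2 V))).IsAcyclic), ∏ x ∈ G, w x) := by
  intro w hw D K e f hsub hDK heD heK hfD hfK hef
  have hΨ : Function.Injective (Sym2.map ψ) := Sym2.map.injective hψ
  -- push the activities forward
  have hw' : ∀ y, 0 ≤ (fun y => if h : ∃ z, Sym2.map ψ z = y then w h.choose else 0) y := by
    intro y
    by_cases h : ∃ z, Sym2.map ψ z = y
    · beta_reduce; rw [dif_pos h]; exact hw _
    · beta_reduce; rw [dif_neg h]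
  have hcomp : ∀ z : Sym2 V, (fun y => if h : ∃ z, Sym2.map ψ z = y then w h.choose else 0) (Sym2.map ψ z) = w z := by
    intro z
    have h : ∃ z', Sym2.map ψ z' = Sym2.map ψ z := ⟨z, rfl⟩
    beta_reduce; rw [dif_pos h, hΨ h.choose_spec]
  have hL : ∀ z ∈ D ∪ insert e (insert f K), ¬z.IsDiag := fun z hz => hT z (hsub hz)
  -- the image instance
  have h := hR (fun y => if h : ∃ z, Sym2.map ψ z = y then w h.choose else 0) hw' (D.image (Sym2.map ψ)) (K.image (Sym2.map ψ))
    (Sym2.map ψ e) (Sym2.map ψ f) ?_ ?_ ?_ ?_ ?_ ?_ (fun hh => hef (hΨ hh))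
  rotate_left
  · intro y hy
    simp only [Finset.mem_union, Finset.mem_insert, Finset.mem_image] at hy
    rcases hy with ⟨z, hz, rfl⟩ | rfl | rfl | ⟨z, hz, rfl⟩
    · exact Finset.mem_image_of_mem _ (hsub (by simp [hz]))
    · exact Finset.mem_image_of_mem _ (hsub (by simp))
    · exact Finset.mem_image_of_mem _ (hsub (by simp))
    · exact Finset.mem_image_of_mem _ (hsub (by simp [hz]))
  · rw [Finset.disjoint_left]
    intro y hyD hyK
    obtain ⟨z, hz, rfl⟩ := Finset.mem_image.1 hyD
    obtain ⟨z', hz', hzz⟩ := Finset.mem_image.1 hyK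
    rw [hΨ hzz] at hz'
    exact Finset.disjoint_left.1 hDK hz hz'
  · intro hh
    obtain ⟨z, hz, hzz⟩ := Finset.mem_image.1 hh
    exact heD (hΨ hzz ▸ hz)
  · intro hh
    obtain ⟨z, hz, hzz⟩ := Finset.mem_image.1 hh
    exact heK (hΨ hzz ▸ hz)
  · intro hh
    obtain ⟨z, hz, hzz⟩ := Finset.mem_image.1 hh
    exact hfD (hΨ hzz ▸ hz)
  · intro hh
    obtain ⟨z, hz, hzz⟩ := Finset.mem_image.1 hh
    exact hfK (hΨ hzz ▸ hz)
  -- pull the four partition functions back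
  have key : ∀ X : Finset (Sym2 V), X ⊆ insert e (insert f K) →
      (∑ G ∈ (D.image (Sym2.map ψ)).powerset.filter (fun G =>
        (fromEdgeSet ((G ∪ X.image (Sym2.map ψ) : Finset (Sym2 U)) : Set (Sym2 U))).IsAcyclic),
        ∏ x ∈ G, (fun y => if h : ∃ z, Sym2.map ψ z = y then w h.choose else 0) x) =
      (∑ G ∈ D.powerset.filter (fun G =>
        (fromEdgeSet ((G ∪ X : Finset (Sym2 V)) : Set (Sym2 V))).IsAcyclic), ∏ x ∈ G, w x) := by
    intro X hX
    rw [forestsW_image ψ hψ _ D X (fun z hz => hL z (Finset.union_subset_union subset_rfl hX hz))]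
    simp only [hcomp]
  have k₁ := key (insert e (insert f K)) subset_rfl
  have k₂ := key K ((Finset.subset_insert _ _).trans (Finset.subset_insert _ _))
  have k₃ := key (insert e K) (Finset.insert_subset_insert e (Finset.subset_insert _ _))
  have k₄ := key (insert f K) (Finset.subset_insert _ _)
  simp only [Finset.image_insert] at k₁ k₃ k₄
  rw [k₁, k₂, k₃, k₄] at h
  exact h

end Summit.CriticalPhenomena.PercolationContinuityZ3.Theorems.ForestRayleigh
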